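import Mathlib.Analysis.Distribution.SchwartzSpace.Basic
import Mathlib.LinearAlgebra.Matrix.Determinant.Basic
import Mathlib.MeasureTheory.Integral.IntervalIntegral.Basic
import Mathlib.Analysis.SpecialFunctions.Pow.Real
import Literature.NumberTheory.LFunctions.ZetaZeros
import HarnessLib
import HarnessLib.Audit

-- provenance: harness21/H21/H21/Statements/RH/ZeroStatistics.lean @ d967f76 (interim HEAD d8f2665); M5 mechanical rewrite
-- 2026-08-15: docstrings and citations checked against the printed sources (Montgomery 1973 via
-- the Borwein–Choi–Rooney–Weirathmueller reprint; Rudnick–Sarnak 1996; Titchmarsh–Heath-Brown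
-- §14.34); locators corrected, open conjectures marked as such. No declaration was changed.
/-!
# Statistics of the zeros of `ζ`: pair correlation and the GUE hypothesis

Family `rh` (trunk `AntSieve`, outline `H21/Outlines/AntSieve.md` §3, item `RHZeroStatistics`).
Target statements **rh.S31** (Montgomery's pair correlation conjecture and Montgomery's theorem on
the form factor `F(α)` for `|α| < 1`) and **rh.S32** (the GUE hypothesis for the `n`-level
correlations of the normalised ordinates, and the Rudnick–Sarnak theorem for test functions with
restricted Fourier support).

## Contents

* `zeroIndexSet T = Finset.range N(T)`, the indices `n` with `γ_n ≤ T`; `mem_zeroIndexSet_iff`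
  (named fact, folklore, dischargeable from the `ZetaZeros` bridge facts).
* `pairCorrelationCount α β T`, `MontgomeryPairCorrelation` (**rh.S31**, Montgomery 1973, (12):
  an OPEN CONJECTURE), `montgomeryWeight`, `montgomeryFormFactor α T = F(α, T)` (Montgomery 1973,
  (1)), `montgomeryFormFactor_neg` (proved), `MontgomeryStrongPairCorrelation` (Montgomery 1973,
  (11): an OPEN CONJECTURE).
* `sineDeterminant x = det (K(x_i - x_j))` (Rudnick–Sarnak (1.5)), `sineDeterminant_fin_two`
  (proved), `levelCorrelationSum n f N` (Rudnick–Sarnak (1.3)), `rsSlice`, `IsRSTestFunction`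
  (TF1–TF3), `rsSliceFourier`, `HasRSFourierSupport`, `rsLimit`, `GUEHypothesisAt`,
  `GUEHypothesis` (**rh.S32**: an OPEN CONJECTURE, Rudnick–Sarnak §1 Remark 1),
  `gueHypothesisAt_one_iff_montgomery` (named fact).
* The THEOREMS of the two sources — Montgomery's theorem on `F(α, T)` for `|α| < 1`
  (`montgomery_pair_correlation_restricted`, `tendsto_montgomeryFormFactor`; Montgomery 1973,
  Theorem) and the Rudnick–Sarnak theorem (`rudnick_sarnak`; Rudnick–Sarnak 1996, Theorem 1.2) —
  are RH-conditional named facts in `Literature/NumberTheory/LFunctions/RHConditionalFacts.lean`;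
  their printed proofs are decomposed and (partly) discharged in `MontgomeryPairCorrelation*.lean`,
  `MontgomeryExplicitFormula*.lean`, `MontgomeryZeroSideProofs.lean`, `RudnickSarnak*.lean`.

## Status of the `Prop`-valued declarations (D-0014)

`MontgomeryPairCorrelation`, `MontgomeryStrongPairCorrelation`, `GUEHypothesisAt k` (`k ≥ 1`) and
`GUEHypothesis` are **open conjectures**, recorded as named `Prop`s and never asserted; there is
nothing to discharge (CONVENTIONS §4: "open conjectures are `def FooConjecture : Prop`"). Only
`mem_zeroIndexSet_iff` and `gueHypothesisAt_one_iff_montgomery` are (unproved here) theorems.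

## Mathlib

Mathlib has `RiemannHypothesis`, `Real.sinc`, `SchwartzMap`, `Matrix.det`, interval integrals and
the Fintype instance on embeddings `Fin n ↪ Fin N` (`Function.Embedding.fintype`); it has nothing
on zero statistics of `ζ` (no pair correlation, sine-kernel determinant, `n`-level correlation).
The zero bookkeeping (`zetaZeroCount = N(T)`, `zetaOrdinate n = γ_n`, `normalizedOrdinate`,
`sineKernel`) is `Literature/NumberTheory/LFunctions/ZetaZeros.lean`.

## Design choices

* Ordinates are indexed with multiplicity by `zetaOrdinate : ℕ → ℝ` (0-indexed, non-decreasing), so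
  "`∑` over `0 < γ, γ' ≤ T` counted with multiplicity" is a sum over pairs of *indices* in
  `zeroIndexSet T := Finset.range (zetaZeroCount T)`, which is `{n | γ_n ≤ T}` by
  `zetaZeroCount_eq_ncard` and monotonicity (`mem_zeroIndexSet_iff`). This keeps every sum a
  `Finset.sum` with no finiteness side condition.
* **rh.S31.** Montgomery's conjecture (Montgomery 1973, (12)) is stated for the closed window
  `2πα / log T ≤ γ - γ' ≤ 2πβ / log T`, `α < β`, with the `δ`-mass of the diagonal `γ = γ'`
  written as the indicator `if 0 ∈ Icc α β then 1 else 0` (Montgomery's `δ(α, β)`), and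
  normalised by `N(T)` instead of Montgomery's `(T/2π) log T` — the form printed in
  Titchmarsh–Heath-Brown §14.34; the two are equivalent by the Riemann–von Mangoldt formula
  `N(T) ∼ (T/2π) log T`. The form factor
  `F(α) = F(α, T) = (2π / (T log T)) ∑ T^{iα(γ-γ')} w(γ-γ')`, `w(u) = 4/(4+u²)` (Montgomery 1973,
  (1)), is real by the symmetry `(γ, γ') ↔ (γ', γ)`, so we *define* it with
  `cos (α log T (γ-γ'))` in place of `T^{iα(γ-γ')}`; this is literally equal to Montgomery's `F`.
  Montgomery's theorem "`F(α) = (1+o(1)) T^{-2α} log T + α + o(1)` uniformly for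
  `0 ≤ α ≤ 1 - ε`" (under RH) is the named fact `montgomery_pair_correlation_restricted` of
  `RHConditionalFacts.lean`, spelled out with explicit `ε`.
* **rh.S32.** Rudnick–Sarnak's `n`-level correlation sums are indexed by the number `N` of zeros,
  `R_n(B_N, f) = (n!/N) ∑_{S ⊆ B_N, |S| = n} f(S)` (Rudnick–Sarnak (1.3))
  `= (1/N) ∑_{j_1,…,j_n ≤ N distinct} f(γ̃_{j_1}, …, γ̃_{j_n})` for symmetric `f`, with the
  normalisation `γ̃ = γ log γ / 2π` (`normalizedOrdinate`; Rudnick–Sarnak p. 269 with `m = 1`);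
  distinct tuples are embeddings `Fin n ↪ Fin N`. The `T`-indexed sum of the outline is
  `levelCorrelationSum n f (zetaZeroCount T)`.
  Test functions (RS conditions TF1–TF3, p. 270) live on `Fin (k+1) → ℝ` (level `n = k + 1`),
  because TF3 and the limit are conditions on the slice `y ↦ f (0, y)` on `Fin k → ℝ ≃`
  (hyperplane `∑ x_i = 0` modulo nothing / `ℝⁿ` modulo the diagonal): for a
  diagonal-translation-invariant integrand `g`,
  `∫_{ℝⁿ} g(x) δ((x_1+⋯+x_n)/n) dx = ∫_{ℝ^{n-1}} g(0, y) dy` (unit Jacobian), which is how we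
  write the RS limit `rsLimit`. Likewise the distributional Fourier transform of a TF2-function
  (diagonal-invariant) is `δ`(diagonal direction) times the transform `Φ` of the slice, and
  "`supp f̂ ⊆ {∑ |ξ_j| < 2}`" (the hypothesis of RS Theorems 1.1/1.2 for `m = 1`) becomes:
  `Φ(η) = 0` whenever `|∑ η_i| + ∑ |η_i| ≥ 2 - δ` for some `δ > 0` (the missing coordinate is
  `ξ_0 = -∑ η_i` on the hyperplane `∑ ξ_j = 0`; the support is compact in the open region, whence
  the `δ`). TF3 is taken as "the slice is a Schwartz function" (inventory: Schwartz test
  functions).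
* Rudnick–Sarnak's Theorem 1.1 (p. 272) is the *smoothed* statement
  `R_n(T, f, h) ∼ (m/2π) T log T ∫ h(r)ⁿ dr ∫ f(x) W_n(x) δ(x̄) dx`, proved **without** RH (for
  entire `f`, `h`, the sums make sense for complex "ordinates"); Theorem 1.2 (p. 273) adds RH and
  concludes `R_n(B_N, f) → ∫ f(x) W_n(x) δ((x_1 + ⋯ + x_n)/n) dx` as `N → ∞`. The tree's named
  fact `rudnick_sarnak` (`RHConditionalFacts.lean`) is exactly Theorem 1.2 for `m = 1`, stated
  under `RiemannHypothesis` as printed (our real-ordinate bookkeeping cannot express the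
  RH-free smoothed version with complex ordinates).
* Junk values: division by `N = 0`, `log T ≤ 0` for `T ≤ 1` only affect an initial segment of the
  `atTop` filters and are irrelevant to every statement.

## References

* H. L. Montgomery, *The pair correlation of zeros of the zeta function*, in: Analytic Number
  Theory (St. Louis 1972), Proc. Sympos. Pure Math. 24, AMS (1973), 181–193: §1, (1) (the form
  factor `F` and the weight `w`), Theorem ((2)), (11) (the conjecture `F(α) = 1 + o(1)` for
  `α ≥ 1`), Conjecture (12) (pair correlation), (15) (the determinantal `k`-tuple conjecture).
  Read in the reprint: P. Borwein, S. Choi, B. Rooney, A. Weirathmueller (eds.), *The Riemann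
  Hypothesis: A Resource for the Afficionado and Virtuoso Alike*, CMS Books in Math., Springer
  (2008), Part II. [key `Montgomery1973`]
* E. C. Titchmarsh, *The Theory of the Riemann Zeta-Function*, 2nd ed. revised by
  D. R. Heath-Brown, OUP (1986), §14.34 (the `N(T)`-normalised form of the conjecture, with
  `δ(α, β)`). [key `Titchmarsh1986`]
* D. A. Goldston, H. L. Montgomery, *Pair correlation of zeros and primes in short intervals*, in:
  Analytic Number Theory and Diophantine Problems (Stillwater 1984), Progr. Math. 70, Birkhäuser
  (1987), 183–203.
* D. A. Goldston, *Notes on pair correlation of zeros and prime numbers*, in: Recent Perspectives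
  in Random Matrix Theory and Number Theory, LMS Lecture Note Ser. 322, CUP (2005), 79–110
  (arXiv:math/0412313), §6: SPC, PCC, Theorem 4 ("Assume RH. SPC implies PCC and SZC").
  [key `Goldston2005`]
* Z. Rudnick, P. Sarnak, *Zeros of principal L-functions and random matrix theory*, Duke Math. J.
  81 (1996), 269–322 (doi:10.1215/S0012-7094-96-08115-6): conditions TF1–TF3 (p. 270), (1.3)
  (`R_n(B_N, f)`), (1.5) (`W_n = det K(x_i - x_j)`), Theorem 1.1 (p. 272), Theorem 1.2 and
  Remark 1 (p. 273). [key `RudnickSarnak1996`]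
* F. J. Dyson, *Statistical theory of the energy levels of complex systems. III*, J. Math. Phys.
  3 (1962), 166–175 (the GUE/CUE `n`-level densities; RS ref. [3]). [key `Dyson1962`]
* N. M. Katz, P. Sarnak, *Zeroes of zeta functions and symmetry*, Bull. AMS 36 (1999), 1–26, §1
  ("GUE hypothesis", Montgomery–Odlyzko law). [key `KatzSarnak1999`]
* A. M. Odlyzko, *On the distribution of spacings between zeros of the zeta function*, Math. Comp.
  48 (1987), 273–308 (numerical evidence).
-/

noncomputable section

open Complex Filter Set MeasureTheory
open scoped Real Topology

namespace Literature.NumberTheory.LFunctions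

/-! ## Indices of zeros up to height `T` -/

/-- The indices `n < N(T)` of the ordinates `γ_n ≤ T`, as a `Finset`; equal to `{n | γ_n ≤ T}`
(`mem_zeroIndexSet_iff`). Sums "over zeros `0 < γ ≤ T` counted with multiplicity"
(Montgomery 1973, (1), (12)) are sums over this set. (Titchmarsh §9.1.) [cite: Montgomery1973, §1 (1)] -/
def zeroIndexSet (T : ℝ) : Finset ℕ :=
  Finset.range (zetaZeroCount T)

/-- `#(zeroIndexSet T) = N(T)` by construction. [folklore] -/
@[simp] theorem card_zeroIndexSet (T : ℝ) : (zeroIndexSet T).card = zetaZeroCount T :=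
  Finset.card_range _

/-- NAMED FACT (folklore; a theorem, dischargeable from the bridge facts `zetaOrdinate_mono` and
`zetaZeroCount_eq_ncard` of `ZetaZeros.lean`): `n ∈ zeroIndexSet T ↔ γ_n ≤ T` — the ordinates are
non-decreasing and `N(T) = #{n | γ_n ≤ T}`. (Titchmarsh §9.1.) [folklore] -/
def mem_zeroIndexSet_iff : Prop :=
  ∀ {T : ℝ} {n : ℕ},
    n ∈ zeroIndexSet T ↔ zetaOrdinate n ≤ T

/-! ## rh.S31: Montgomery's pair correlation -/

open scoped Classical in
/-- The pair correlation count
`#{(γ, γ') ∈ (0, T]², 2πα / log T ≤ γ - γ' ≤ 2πβ / log T}`, pairs of zeros counted with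
multiplicity (i.e. pairs of indices in `zeroIndexSet T`), diagonal included: the left-hand side
`∑_{0<γ,γ'≤T, 2πα/log T ≤ γ-γ' ≤ 2πβ/log T} 1` of Montgomery's Conjecture (Montgomery, Proc.
Sympos. Pure Math. 24 (1973), §1, (12)). [cite: Montgomery1973, §1 Conjecture (12)] -/
def pairCorrelationCount (α β T : ℝ) : ℕ :=
  ((zeroIndexSet T ×ˢ zeroIndexSet T).filter fun p ↦
    2 * π * α / Real.log T ≤ zetaOrdinate p.1 - zetaOrdinate p.2 ∧
      zetaOrdinate p.1 - zetaOrdinate p.2 ≤ 2 * π * β / Real.log T).card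

open scoped Classical in
/-- **rh.S31** — **Montgomery's pair correlation conjecture.** OPEN CONJECTURE (a named `Prop`,
never asserted; there is nothing to discharge). H. L. Montgomery, *The pair correlation of zeros
of the zeta function*, Proc. Sympos. Pure Math. 24 (1973), §1, Conjecture, eq. (12), as printed:
"CONJECTURE. For fixed `α < β`,
`∑_{0<γ,γ'≤T, 2πα/log T ≤ γ-γ' ≤ 2πβ/log T} 1 ∼ (∫_α^β 1 - ((sin πu)/(πu))² du + δ(α, β)) (T/2π) log T`
as `T` tends to infinity. Here `δ(α, β) = 1` if `0 ∈ [α, β]`, `δ(α, β) = 0` otherwise." ("The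
Dirac `δ`-function occurs naturally in the above, for if `0 ∈ [α, β]` then the sum includes
terms `γ = γ'`.") Montgomery assumes RH throughout his paper and arrives at (12) heuristically
from his Theorem and (11) (`MontgomeryStrongPairCorrelation`; "the assertions (11) and (12) are
essentially equivalent"); the conjecture itself is a statement about the ordinates and is
recorded without RH and normalised by `N(T)` in place of `(T/2π) log T`, which is the form
printed in Titchmarsh–Heath-Brown (1986) §14.34:
`(1/N(T)) #{(γ, γ') ∈ (0,T]² : 2πα/log T ≤ γ - γ' ≤ 2πβ/log T} → ∫_α^β (1 - (sin πu / πu)²) du + δ(α, β)`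
as `T → ∞` (equivalent to (12) by `N(T) ∼ (T/2π) log T`, the right-hand side being positive for
`α < β`). Zeros are counted with multiplicity (`zeroIndexSet`). [cite: Montgomery1973, §1 Conjecture (12)] -/
@[conjecture] def MontgomeryPairCorrelation : Prop :=
  ∀ α β : ℝ, α < β →
    Tendsto (fun T : ℝ ↦ (pairCorrelationCount α β T : ℝ) / zetaZeroCount T) atTop
      (𝓝 ((∫ u in α..β, (1 - sineKernel u ^ 2)) + if (0 : ℝ) ∈ Icc α β then 1 else 0))

/-- Montgomery's weight `w(u) = 4 / (4 + u²)` ("a suitable weighting function … so `w(0) = 1`";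
Montgomery 1973, §1, the sentence after (1)). [cite: Montgomery1973, §1 (1)] -/
def montgomeryWeight (u : ℝ) : ℝ :=
  4 / (4 + u ^ 2)

/-- Montgomery's form factor (Montgomery 1973, §1, (1))
`F(α) = F(α, T) = ((T/2π) log T)⁻¹ ∑_{0 < γ ≤ T, 0 < γ' ≤ T} T^{iα(γ - γ')} w(γ - γ')`,
`w(u) = 4/(4+u²)`, zeros counted with multiplicity. The sum is real (swap `γ ↔ γ'`; "`F(α)` is
real", Montgomery's Theorem), and we write its general term as
`cos (α log T (γ - γ')) w(γ - γ')`, which gives literally the same value; the prefactor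
`((T/2π) log T)⁻¹` is written `2π / (T log T)`. [cite: Montgomery1973, §1 (1)] -/
def montgomeryFormFactor (α T : ℝ) : ℝ :=
  2 * π / (T * Real.log T) * ∑ p ∈ zeroIndexSet T ×ˢ zeroIndexSet T,
    Real.cos (α * Real.log T * (zetaOrdinate p.1 - zetaOrdinate p.2)) *
      montgomeryWeight (zetaOrdinate p.1 - zetaOrdinate p.2)

/-- `F` is even in `α`: `F(-α, T) = F(α, T)` (Montgomery 1973, Theorem: "`F(α)` is real, and
`F(α) = F(-α)`"; immediate here from the `cos` form). [cite: Montgomery1973, §1 Theorem] -/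
theorem montgomeryFormFactor_neg (α T : ℝ) :
    montgomeryFormFactor (-α) T = montgomeryFormFactor α T := by
  simp [montgomeryFormFactor]

/-- **Montgomery's strong pair correlation conjecture** in form-factor language. OPEN CONJECTURE
(a named `Prop`, never asserted). Montgomery 1973, §1, (11): "two heuristic arguments … suggest
that `F(α) = 1 + o(1)` for `α ≥ 1`, uniformly in bounded intervals. This, with the Theorem,
completely determines `F`", and "the assertions (11) and (12) are essentially equivalent"
((12) = `MontgomeryPairCorrelation`; the deduction of (12) from the Theorem and the version of
(11) uniform on bounded intervals `1 ≤ α ≤ M` is written out, under RH, in Goldston 2005,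
Theorem 4: "SPC implies PCC"). We record the pointwise version, `F(α, T) → 1` as `T → ∞` for
each fixed `|α| ≥ 1` (`F` is even, `montgomeryFormFactor_neg`), which the printed locally
uniform one implies. [cite: Montgomery1973, §1 (11)] -/
@[conjecture] def MontgomeryStrongPairCorrelation : Prop :=
  ∀ α : ℝ, 1 ≤ |α| → Tendsto (montgomeryFormFactor α) atTop (𝓝 1)

/-! ## rh.S32: `n`-level correlations and the GUE hypothesis -/

/-- The sine-kernel determinant `W_n(x) = det (K(x_i - x_j))_{i,j}`, `K(x) = sin(πx)/(πx)`
(`sineKernel`), Dyson's GUE `n`-level correlation density (Dyson 1962; Rudnick–Sarnak, Duke 81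
(1996), (1.5); conjectured for the zeros of `ζ` by Montgomery 1973, (15)). Stated for any finite
index type. [cite: Dyson1962] -/
def sineDeterminant {ι : Type*} [Fintype ι] [DecidableEq ι] (x : ι → ℝ) : ℝ :=
  (Matrix.of fun i j : ι ↦ sineKernel (x i - x j)).det

/-- For two points, `W_2(x) = 1 - K(x_0 - x_1)^2`, Montgomery's pair correlation density
(`K` is even; Montgomery 1973, (12) and (15) with `k = 2`). [cite: Montgomery1973, §1 (15)] -/
theorem sineDeterminant_fin_two (x : Fin 2 → ℝ) :
    sineDeterminant x = 1 - sineKernel (x 0 - x 1) ^ 2 := by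
  simp [sineDeterminant, Matrix.det_fin_two, sineKernel, sq, ← Real.sinc_neg (π * (x 0 - x 1)),
    ← mul_neg]

/-- The un-normalised `n`-level correlation sum of the first `N` normalised ordinates
`B_N = {γ̃_0, …, γ̃_{N-1}}`, `γ̃ = γ log γ / 2π`:
`∑_{j : Fin n ↪ Fin N} f(γ̃_{j 0}, …, γ̃_{j (n-1)})`, a sum over ordered `n`-tuples of *distinct*
indices (zeros repeated according to multiplicity), so that Rudnick–Sarnak's
`R_n(B_N, f) = (n!/N) ∑_{S ⊆ B_N, |S| = n} f(S)` (Duke 81 (1996), (1.3)) equals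
`levelCorrelationSum n f N / N` for symmetric `f`. The `T`-indexed sum over `0 < γ ≤ T` is
`levelCorrelationSum n f (zetaZeroCount T)`. (Katz–Sarnak, Bull. AMS 36 (1999), §1.) [cite: RudnickSarnak1996, (1.3)] -/
def levelCorrelationSum (n : ℕ) (f : (Fin n → ℝ) → ℂ) (N : ℕ) : ℂ :=
  ∑ j : Fin n ↪ Fin N, f fun i ↦ normalizedOrdinate (j i)

/-- The slice `y ↦ f (0, y_1, …, y_k)` of a function of `k + 1` real variables: a cross-section
of `ℝ^{k+1}` modulo the diagonal `ℝ · (1, …, 1)`, with unit Jacobian against the hyperplane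
measure `δ((x_0 + ⋯ + x_k)/(k+1)) dx` for diagonal-invariant integrands
(Rudnick–Sarnak 1996, §1, TF2–TF3 and Theorem 1.2). [cite: RudnickSarnak1996, §1] -/
def rsSlice {k : ℕ} (f : (Fin (k + 1) → ℝ) → ℂ) (y : Fin k → ℝ) : ℂ :=
  f (Fin.cons 0 y)

/-- Rudnick–Sarnak test functions at level `n = k + 1` (Duke 81 (1996), §1, p. 270, conditions
TF1–TF3, as printed): TF1 "`f(x_1, …, x_n)` is symmetric"; TF2 "`f(x + t(1, …, 1)) = f(x)` for
`t ∈ ℝ`"; TF3 "`f(x) → 0` rapidly as `|x| → ∞` in the hyperplane `∑ x_j = 0`", taken here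
(inventory rh.S32: Schwartz test functions) as: the slice `y ↦ f(0, y)` is a Schwartz function
on `ℝ^k`. (The fields are listed in the order TF2, TF1, TF3.) [cite: RudnickSarnak1996, §1 TF1–TF3] -/
structure IsRSTestFunction (k : ℕ) (f : (Fin (k + 1) → ℝ) → ℂ) : Prop where
  /-- TF2: invariance under diagonal translation. -/
  diag_invariant : ∀ (x : Fin (k + 1) → ℝ) (t : ℝ), f (fun i ↦ x i + t) = f x
  /-- TF1: symmetry under permutation of the coordinates. -/
  symmetric : ∀ (σ : Equiv.Perm (Fin (k + 1))) (x : Fin (k + 1) → ℝ), f (x ∘ σ) = f x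
  /-- TF3: the slice `y ↦ f (0, y)` is a Schwartz function. -/
  schwartz_slice : ∃ g : SchwartzMap (Fin k → ℝ) ℂ, ⇑g = rsSlice f

/-- The Fourier transform of a diagonal-invariant `f` *along the hyperplane* `∑ ξ_j = 0`, in the
coordinates `η = (ξ_1, …, ξ_k)` (so `ξ_0 = -∑ η_i`):
`Φ_f(η) = ∫_{ℝ^k} f(0, y) e(-y · η) dy`. The distributional transform of `f` on `ℝ^{k+1}` is
`δ`(diagonal direction) `⊗ Φ_f`. (Rudnick–Sarnak 1996, §1: the support hypothesis of
Theorems 1.1/1.2 is a condition on `f̂`.) [cite: RudnickSarnak1996, §1] -/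
def rsSliceFourier {k : ℕ} (f : (Fin (k + 1) → ℝ) → ℂ) (η : Fin k → ℝ) : ℂ :=
  ∫ y : Fin k → ℝ, rsSlice f y * Complex.exp (-(2 * π * I * ∑ i, (y i * η i : ℝ)))

/-- Rudnick–Sarnak's support restriction "`f̂(ξ)` is supported in `∑_j |ξ_j| < 2/m`", the
hypothesis of Theorems 1.1 and 1.2 (Duke 81 (1996)), for `m = 1` (`L = ζ`): in slice coordinates,
`ξ_0 = -∑ η_i` and the (compact) support of `Φ_f` lies in the open region, i.e. there is `δ > 0`
with `Φ_f(η) = 0` whenever `|∑ η_i| + ∑ |η_i| ≥ 2 - δ`. [cite: RudnickSarnak1996, Thm 1.1 (support hypothesis)] -/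
def HasRSFourierSupport (k : ℕ) (f : (Fin (k + 1) → ℝ) → ℂ) : Prop :=
  ∃ δ : ℝ, 0 < δ ∧ ∀ η : Fin k → ℝ, 2 - δ ≤ |∑ i, η i| + ∑ i, |η i| → rsSliceFourier f η = 0

/-- The GUE `(k+1)`-level limit
`∫_{ℝ^{k+1}} f(x) W_{k+1}(x) δ((x_0 + ⋯ + x_k)/(k+1)) dx = ∫_{ℝ^k} f(0, y) W_{k+1}(0, y) dy`
(equal for diagonal-invariant integrands; unit Jacobian): the right-hand side of Rudnick–Sarnak's
Theorem 1.2 (Duke 81 (1996), p. 273). [cite: RudnickSarnak1996, Thm 1.2] -/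
def rsLimit (k : ℕ) (f : (Fin (k + 1) → ℝ) → ℂ) : ℂ :=
  ∫ y : Fin k → ℝ, rsSlice f y * (sineDeterminant (Fin.cons 0 y : Fin (k + 1) → ℝ) : ℂ)

/-- The GUE hypothesis at level `n = k + 1`. OPEN CONJECTURE for `k ≥ 1` (a named `Prop`, never
asserted): for every Rudnick–Sarnak test function `f` (no restriction on the support of `f̂`),
`R_{k+1}(B_N, f) = levelCorrelationSum (k+1) f N / N → rsLimit k f` as `N → ∞`. This is the
conclusion of Rudnick–Sarnak's Theorem 1.2 without its support hypothesis, conjectured in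
Rudnick–Sarnak 1996, §1, Remark 1 (p. 273): "In all cases we conjecture the complete
universality of the `n`-level correlations — that is to say that Theorems 1.1 and 1.2 hold
without any restrictions on the support of `f̂`." (Katz–Sarnak 1999, §1: the "GUE hypothesis".) [cite: RudnickSarnak1996, §1 Remark 1] -/
def GUEHypothesisAt (k : ℕ) : Prop :=
  ∀ f : (Fin (k + 1) → ℝ) → ℂ, IsRSTestFunction k f →
    Tendsto (fun N : ℕ ↦ levelCorrelationSum (k + 1) f N / N) atTop (𝓝 (rsLimit k f))

/-- **rh.S32** — **the GUE hypothesis** (Montgomery–Odlyzko law) for all levels `n ≥ 2`. OPEN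
CONJECTURE (a named `Prop`, never asserted; nothing to discharge): for every `n ≥ 2` and every
Rudnick–Sarnak test function `f` on `ℝⁿ` (symmetric, diagonal-invariant, Schwartz on the
hyperplane), the `n`-level correlations of the normalised ordinates `γ̃ = γ log γ / 2π` converge
to `∫ f(x) det (K(x_i - x_j)) δ(x̄) dx`, `K(x) = sin(πx)/(πx)` (Rudnick–Sarnak 1996, §1,
Remark 1: complete universality, i.e. Theorem 1.2 with no restriction on `supp f̂`; the
determinant is Dyson's (1.5), conjectured for `ζ` by Montgomery 1973, (15); numerical evidence:
Odlyzko, Math. Comp. 48 (1987); terminology: Katz–Sarnak 1999, §1). [cite: RudnickSarnak1996, §1 Remark 1] -/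
@[conjecture] def GUEHypothesis : Prop :=
  ∀ k : ℕ, 1 ≤ k → GUEHypothesisAt k

/-- NAMED FACT (a theorem by a standard approximation argument, not discharged here): the
`2`-level GUE hypothesis (for all Rudnick–Sarnak test functions of two variables, `N`-indexed,
normalisation `γ̃ = γ log γ / 2π`) is equivalent to Montgomery's pair correlation conjecture (box
windows, normalisation `(γ - γ') log T / 2π`, limit in `T`): monotone approximation of box
indicators by Schwartz functions and conversely Riemann sums of boxes, using
`N(T + 1) - N(T) ≪ log T` for the tails, `log γ ∼ log T` for all but `o(N(T))` ordinates
`γ ≤ T` to exchange the normalisations, and `sineDeterminant_fin_two`. (Rudnick–Sarnak 1996,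
§1, Remark 1: "In the case of `ζ(s)` and `n = 2`, Theorem 1.2 coincides with the result of
Montgomery"; Katz–Sarnak 1999, §1.) [cite: RudnickSarnak1996, §1 Remark 1] -/
def gueHypothesisAt_one_iff_montgomery : Prop :=
  GUEHypothesisAt 1 ↔ MontgomeryPairCorrelation

end Literature.NumberTheory.LFunctions
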